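import Literature.Analysis.FunctionSpaces.TorusTestFunction
import Literature.Analysis.FunctionSpaces.TorusInverseLaplacianCalculus
import HarnessLib

/-!
# The tested steady Navier–Stokes form on `T^d`: linearity and the exact Taylor remainder

FluidPDE support file (everything proved; no definitions, no named facts).  The steady
Navier–Stokes equations on the flat torus, tested against a smooth field `a` after integration
by parts, read `T(U; a) := ∫ (⟪U, (U·∇)a⟫ + ν ⟪U, Δa⟫ + ⟪f, a⟫) = 0` (Temam 1979, Ch. II §1,
(1.25): `ν((u, a)) + b(u, u, a) = (f, a)` with `b` moved onto the test).  `U ↦ T(U; a)` is a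
quadratic polynomial; its linearisation at `V` in the direction `W` is
`L(V; W, a) := ∫ (⟪W, (V·∇)a⟫ + ⟪V, (W·∇)a⟫ + ν ⟪W, Δa⟫)`.  This file records, for smooth data and
with all integrals written out (so that problem-side wrappers such as `testedForm`/`linForm`
unfold to them definitionally):

* `integral_tested_add_test` / `integral_tested_smul_test` — `T(U; ·)` is linear in the test;
* `integral_linearised_add_dir` / `integral_linearised_smul_dir` — `L(V; ·, a)` is linear;
* `integral_linearised_add_test` / `integral_linearised_smul_test` — `L(V; W, ·)` is linear;
* `integral_tested_sub_sub_linearised` — the **exact Taylor remainder**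
  `T(X; a) − T(Y; a) − L(V; X − Y, a) = ∫ ⟪X − Y, ((X − V)·∇)a⟫ + ∫ ⟪Y − V, ((X − Y)·∇)a⟫`,
  the identity behind the Lipschitz constant of `U ↦ DT(U)` in Newton–Kantorovich / Brezzi–
  Rappaz–Raviart arguments for Galerkin steady states (Girault–Raviart 1986, Ch. IV §3).

## Mathlib / tree search

Tree: `Torus.convect`, `Torus.laplacian`, `Torus.fderiv_add`, `Torus.fderiv_const_smul`
(`TorusTestFunction`), `Torus.laplacian_add_apply` (`TorusInverseLaplacianCalculus`),
`Torus.laplacian_const_smul_apply` (`TorusFourierConvolution`); the problem-side file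
`Summits/…/MirrorVarietyTaylorGreenLoudGalerkinStatesStubCriticality.lean` has the test-linearity
for its wrapper `testedForm`.  Nothing on the linearised form (searched `linearis`, `convect (`).

## References

* R. Temam, *Navier–Stokes Equations*, North-Holland (1979), Ch. II §1, (1.25). [Temam1979]
* V. Girault, P.-A. Raviart, *Finite Element Methods for Navier–Stokes Equations*, Springer
  (1986), Ch. IV §3.
-/

noncomputable section

open _root_.MeasureTheory Set Filter Function UnitAddTorus
open scoped ENNReal NNReal InnerProductSpace

namespace Literature.Analysis.FluidPDE

open FunctionSpaces FunctionSpaces.Torus Torus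

variable {d : Type*} [Fintype d] [DecidableEq d]
variable {ν : ℝ} {f U V W W₁ W₂ X Y a b : UnitAddTorus d → EuclideanSpace ℝ d}

/-! ### Integrability of the integrands (continuous on the compact torus) -/

omit [DecidableEq d] in
/-- The tested steady integrand is integrable for continuous force and smooth `U`, `a`. [folklore] -/
theorem integrable_tested_integrand (ν : ℝ) (hf : Continuous f) (hU : IsSmooth U) (ha : IsSmooth a) :
    Integrable (fun x => ⟪U x, FunctionSpaces.Torus.convect U a x⟫_ℝ + ν * ⟪U x, FunctionSpaces.Torus.laplacian a x⟫_ℝ + ⟪f x, a x⟫_ℝ) volume :=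
  (((hU.inner (hU.convect ha)).integrable).add
      ((hU.inner ha.laplacian).integrable.const_mul ν)).add
    (hf.inner ha.continuous).integrable_unitAddTorus

omit [DecidableEq d] in
/-- The linearised integrand is integrable for smooth `V`, `W`, `a`. [folklore] -/
theorem integrable_linearised_integrand (ν : ℝ) (hV : IsSmooth V) (hW : IsSmooth W) (ha : IsSmooth a) :
    Integrable (fun x => ⟪W x, FunctionSpaces.Torus.convect V a x⟫_ℝ + ⟪V x, FunctionSpaces.Torus.convect W a x⟫_ℝ + ν * ⟪W x, FunctionSpaces.Torus.laplacian a x⟫_ℝ)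
      volume :=
  (((hW.inner (hV.convect ha)).integrable).add (hV.inner (hW.convect ha)).integrable).add
    ((hW.inner ha.laplacian).integrable.const_mul ν)

/-! ### Linearity in the test -/

/-- `T(U; a + b) = T(U; a) + T(U; b)` for smooth tests. [cite: Temam1979, Ch. II §1 (1.25)] -/
theorem integral_tested_add_test (hf : Continuous f) (hU : IsSmooth U) (ha : IsSmooth a) (hb : IsSmooth b) :
    ∫ x, (⟪U x, FunctionSpaces.Torus.convect U (a + b) x⟫_ℝ + ν * ⟪U x, FunctionSpaces.Torus.laplacian (a + b) x⟫_ℝ + ⟪f x, (a + b) x⟫_ℝ) =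
      (∫ x, (⟪U x, FunctionSpaces.Torus.convect U a x⟫_ℝ + ν * ⟪U x, FunctionSpaces.Torus.laplacian a x⟫_ℝ + ⟪f x, a x⟫_ℝ)) +
        ∫ x, (⟪U x, FunctionSpaces.Torus.convect U b x⟫_ℝ + ν * ⟪U x, FunctionSpaces.Torus.laplacian b x⟫_ℝ + ⟪f x, b x⟫_ℝ) := by
  rw [← integral_add (integrable_tested_integrand ν hf hU ha) (integrable_tested_integrand ν hf hU hb)]
  refine integral_congr_ae (ae_of_all _ fun x => ?_)
  have hc : FunctionSpaces.Torus.convect U (a + b) x = FunctionSpaces.Torus.convect U a x + FunctionSpaces.Torus.convect U b x := by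
    simp only [FunctionSpaces.Torus.convect]
    rw [Torus.fderiv_add (ha.isContDiff (by simp)) (hb.isContDiff (by simp))]
    rfl
  beta_reduce
  rw [hc, laplacian_add_apply ha hb x, Pi.add_apply, inner_add_right, inner_add_right, inner_add_right]
  ring

omit [DecidableEq d] in
/-- `T(U; r • a) = r T(U; a)` for smooth tests. [cite: Temam1979, Ch. II §1 (1.25)] -/
theorem integral_tested_smul_test (r : ℝ) (ha : IsSmooth a) :
    ∫ x, (⟪U x, FunctionSpaces.Torus.convect U (r • a) x⟫_ℝ + ν * ⟪U x, FunctionSpaces.Torus.laplacian (r • a) x⟫_ℝ + ⟪f x, (r • a) x⟫_ℝ) =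
      r * ∫ x, (⟪U x, FunctionSpaces.Torus.convect U a x⟫_ℝ + ν * ⟪U x, FunctionSpaces.Torus.laplacian a x⟫_ℝ + ⟪f x, a x⟫_ℝ) := by
  rw [← integral_const_mul]
  refine integral_congr_ae (ae_of_all _ fun x => ?_)
  have hc : FunctionSpaces.Torus.convect U (r • a) x = r • FunctionSpaces.Torus.convect U a x := by
    simp only [FunctionSpaces.Torus.convect]
    rw [Torus.fderiv_const_smul (ha.isContDiff (by simp))]
    rfl
  beta_reduce
  rw [hc, laplacian_const_smul_apply ha r x, Pi.smul_apply, inner_smul_right, inner_smul_right,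
    inner_smul_right]
  ring

/-! ### Linearity of the linearised form -/

omit [DecidableEq d] in
/-- `L(V; W₁ + W₂, a) = L(V; W₁, a) + L(V; W₂, a)`. [folklore] -/
theorem integral_linearised_add_dir (hV : IsSmooth V) (hW₁ : IsSmooth W₁) (hW₂ : IsSmooth W₂)
    (ha : IsSmooth a) :
    ∫ x, (⟪(W₁ + W₂) x, FunctionSpaces.Torus.convect V a x⟫_ℝ + ⟪V x, FunctionSpaces.Torus.convect (W₁ + W₂) a x⟫_ℝ +
        ν * ⟪(W₁ + W₂) x, FunctionSpaces.Torus.laplacian a x⟫_ℝ) =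
      (∫ x, (⟪W₁ x, FunctionSpaces.Torus.convect V a x⟫_ℝ + ⟪V x, FunctionSpaces.Torus.convect W₁ a x⟫_ℝ + ν * ⟪W₁ x, FunctionSpaces.Torus.laplacian a x⟫_ℝ)) +
        ∫ x, (⟪W₂ x, FunctionSpaces.Torus.convect V a x⟫_ℝ + ⟪V x, FunctionSpaces.Torus.convect W₂ a x⟫_ℝ + ν * ⟪W₂ x, FunctionSpaces.Torus.laplacian a x⟫_ℝ) := by
  rw [← integral_add (integrable_linearised_integrand ν hV hW₁ ha)
    (integrable_linearised_integrand ν hV hW₂ ha)]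
  refine integral_congr_ae (ae_of_all _ fun x => ?_)
  simp only [FunctionSpaces.Torus.convect, Pi.add_apply, map_add, inner_add_left, inner_add_right]
  ring

omit [DecidableEq d] in
/-- `L(V; r • W, a) = r L(V; W, a)`. [folklore] -/
theorem integral_linearised_smul_dir (r : ℝ) :
    ∫ x, (⟪(r • W) x, FunctionSpaces.Torus.convect V a x⟫_ℝ + ⟪V x, FunctionSpaces.Torus.convect (r • W) a x⟫_ℝ + ν * ⟪(r • W) x, FunctionSpaces.Torus.laplacian a x⟫_ℝ) =
      r * ∫ x, (⟪W x, FunctionSpaces.Torus.convect V a x⟫_ℝ + ⟪V x, FunctionSpaces.Torus.convect W a x⟫_ℝ + ν * ⟪W x, FunctionSpaces.Torus.laplacian a x⟫_ℝ) := by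
  rw [← integral_const_mul]
  refine integral_congr_ae (ae_of_all _ fun x => ?_)
  simp only [FunctionSpaces.Torus.convect, Pi.smul_apply, map_smul, inner_smul_left, inner_smul_right, RCLike.conj_to_real]
  ring

/-- `L(V; W, a + b) = L(V; W, a) + L(V; W, b)` for smooth tests. [folklore] -/
theorem integral_linearised_add_test (hV : IsSmooth V) (hW : IsSmooth W) (ha : IsSmooth a)
    (hb : IsSmooth b) :
    ∫ x, (⟪W x, FunctionSpaces.Torus.convect V (a + b) x⟫_ℝ + ⟪V x, FunctionSpaces.Torus.convect W (a + b) x⟫_ℝ + ν * ⟪W x, FunctionSpaces.Torus.laplacian (a + b) x⟫_ℝ) =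
      (∫ x, (⟪W x, FunctionSpaces.Torus.convect V a x⟫_ℝ + ⟪V x, FunctionSpaces.Torus.convect W a x⟫_ℝ + ν * ⟪W x, FunctionSpaces.Torus.laplacian a x⟫_ℝ)) +
        ∫ x, (⟪W x, FunctionSpaces.Torus.convect V b x⟫_ℝ + ⟪V x, FunctionSpaces.Torus.convect W b x⟫_ℝ + ν * ⟪W x, FunctionSpaces.Torus.laplacian b x⟫_ℝ) := by
  rw [← integral_add (integrable_linearised_integrand ν hV hW ha)
    (integrable_linearised_integrand ν hV hW hb)]
  refine integral_congr_ae (ae_of_all _ fun x => ?_)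
  have hD : Torus.fderiv (a + b) x = Torus.fderiv a x + Torus.fderiv b x :=
    Torus.fderiv_add (ha.isContDiff (by simp)) (hb.isContDiff (by simp)) x
  simp only [FunctionSpaces.Torus.convect, hD, _root_.add_apply, laplacian_add_apply ha hb x, inner_add_right]
  ring

omit [DecidableEq d] in
/-- `L(V; W, r • a) = r L(V; W, a)` for smooth tests. [folklore] -/
theorem integral_linearised_smul_test (r : ℝ) (ha : IsSmooth a) :
    ∫ x, (⟪W x, FunctionSpaces.Torus.convect V (r • a) x⟫_ℝ + ⟪V x, FunctionSpaces.Torus.convect W (r • a) x⟫_ℝ + ν * ⟪W x, FunctionSpaces.Torus.laplacian (r • a) x⟫_ℝ) =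
      r * ∫ x, (⟪W x, FunctionSpaces.Torus.convect V a x⟫_ℝ + ⟪V x, FunctionSpaces.Torus.convect W a x⟫_ℝ + ν * ⟪W x, FunctionSpaces.Torus.laplacian a x⟫_ℝ) := by
  rw [← integral_const_mul]
  refine integral_congr_ae (ae_of_all _ fun x => ?_)
  have hD : Torus.fderiv (r • a) x = r • Torus.fderiv a x :=
    Torus.fderiv_const_smul (ha.isContDiff (by simp)) r x
  simp only [FunctionSpaces.Torus.convect, hD, _root_.smul_apply, laplacian_const_smul_apply ha r x,
    inner_smul_right]
  ring

/-! ### The exact Taylor remainder of the quadratic map `U ↦ T(U; ·)` -/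

omit [DecidableEq d] in
/-- **Exact Taylor remainder of the tested steady form.**  For continuous `f` and smooth
`X, Y, V, a`:
`T(X; a) − T(Y; a) − L(V; X − Y, a) = ∫ ⟪X − Y, ((X − V)·∇)a⟫ + ∫ ⟪Y − V, ((X − Y)·∇)a⟫`
(pointwise polarisation of the quadratic form `U ↦ ⟪U, Da[U]⟩`; the `ν`- and `f`-terms are affine
and cancel).  With a trilinear bound `|∫⟪u, (z·∇)a⟫| ≤ C‖u‖‖z‖‖a‖` this gives the centred
Lipschitz estimate `‖DT(X) − DT(Y)‖`-type bound `C(‖X − V‖ + ‖Y − V‖)‖X − Y‖‖a‖` used by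
Newton–Kantorovich. [folklore] -/
theorem integral_tested_sub_sub_linearised (ν : ℝ) (hf : Continuous f) (hX : IsSmooth X)
    (hY : IsSmooth Y) (hV : IsSmooth V) (ha : IsSmooth a) :
    (∫ x, (⟪X x, FunctionSpaces.Torus.convect X a x⟫_ℝ + ν * ⟪X x, FunctionSpaces.Torus.laplacian a x⟫_ℝ + ⟪f x, a x⟫_ℝ)) -
        (∫ x, (⟪Y x, FunctionSpaces.Torus.convect Y a x⟫_ℝ + ν * ⟪Y x, FunctionSpaces.Torus.laplacian a x⟫_ℝ + ⟪f x, a x⟫_ℝ)) -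
        (∫ x, (⟪(X - Y) x, FunctionSpaces.Torus.convect V a x⟫_ℝ + ⟪V x, FunctionSpaces.Torus.convect (X - Y) a x⟫_ℝ +
          ν * ⟪(X - Y) x, FunctionSpaces.Torus.laplacian a x⟫_ℝ)) =
      (∫ x, ⟪(X - Y) x, FunctionSpaces.Torus.convect (X - V) a x⟫_ℝ) + ∫ x, ⟪(Y - V) x, FunctionSpaces.Torus.convect (X - Y) a x⟫_ℝ := by
  have iX := integrable_tested_integrand ν hf hX ha
  have iY := integrable_tested_integrand ν hf hY ha
  have iL := integrable_linearised_integrand ν hV (hX.sub hY) ha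
  have i1 : Integrable (fun x => ⟪(X - Y) x, FunctionSpaces.Torus.convect (X - V) a x⟫_ℝ) volume :=
    ((hX.sub hY).inner ((hX.sub hV).convect ha)).integrable
  have i2 : Integrable (fun x => ⟪(Y - V) x, FunctionSpaces.Torus.convect (X - Y) a x⟫_ℝ) volume :=
    ((hY.sub hV).inner ((hX.sub hY).convect ha)).integrable
  have iXY : Integrable (fun x => (⟪X x, FunctionSpaces.Torus.convect X a x⟫_ℝ + ν * ⟪X x, FunctionSpaces.Torus.laplacian a x⟫_ℝ + ⟪f x, a x⟫_ℝ) -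
      (⟪Y x, FunctionSpaces.Torus.convect Y a x⟫_ℝ + ν * ⟪Y x, FunctionSpaces.Torus.laplacian a x⟫_ℝ + ⟪f x, a x⟫_ℝ)) volume := iX.sub iY
  rw [← integral_sub iX iY, ← integral_sub iXY iL, ← integral_add i1 i2]
  refine integral_congr_ae (ae_of_all _ fun x => ?_)
  simp only [FunctionSpaces.Torus.convect, Pi.sub_apply, map_sub, inner_sub_left, inner_sub_right]
  ring

end Literature.Analysis.FluidPDE

end
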